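import Summits.HodgeConjecture.HodgeCM.PerL34.FockGroupInvariants_1

/-! PORT of `HodgeCM/PerL34/FockGroupInvariants.lean` (HodgeCMPerL run 81) — part 2: continuation of `Summits.HodgeConjecture.HodgeCM.PerL34.FockGroupInvariants_1` (split at a top-level declaration boundary by port_pkg.py; scope re-opened below; declarations unchanged). -/

-- port_pkg: scope re-opened for this part (file-level context, then the namespace/section stack open at the cut)
set_option autoImplicit false
open MvPolynomial Finsupp
open scoped BigOperators ComplexConjugate
namespace HodgeCM
namespace PerL34
namespace Fock
namespace GroupLevel
section Plane
/-! ### Torus elements: `diag(x, 1)`, `diag(1, x)` in `U(2)_V` and `t ∈ U(1)_V` act diagonally on monomials -/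

/-- (Ported verbatim from the HodgeCMPerL package; no docstring in the source.) -/
theorem rowSubst_diagonal (d : Fin 2 → ℂ) (t : ℂ) :
    rowSubst (Matrix.diagonal d) t = scale (Sum.elim (fun v : Fin 2 × Fin 2 => d v.1) fun _ => conj t) := by
  refine MvPolynomial.algHom_ext fun v => ?_
  rw [scale_X]
  rcases v with ⟨a, j⟩ | j
  · rw [show (X (Sum.inl (a, j)) : PlaneModel) = z a j from rfl, rowSubst_z]
    simp [Matrix.diagonal_apply, smul_eq_C_mul, z]
  · rw [show (X (Sum.inr j) : PlaneModel) = w j from rfl, rowSubst_w]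
    simp [smul_eq_C_mul, w]

/-- The torus element of `U(2)_V` with `x` in position `a` and `1` elsewhere. -/
noncomputable def torV (a : Fin 2) (x : ℂ) : Fin 2 → ℂ := fun b => if b = a then x else 1

/-- (Ported verbatim from the HodgeCMPerL package; no docstring in the source.) -/
theorem det_torV (a : Fin 2) (x : ℂ) : (Matrix.diagonal (torV a x)).det = x := by
  rw [Matrix.det_diagonal]
  fin_cases a <;> simp [torV, Fin.prod_univ_two]

/-- (Ported verbatim from the HodgeCMPerL package; no docstring in the source.) -/
theorem torV_mem (a : Fin 2) {x : ℂ} (hx : x * conj x = 1) :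
    Matrix.diagonal (torV a x) ∈ Matrix.unitaryGroup (Fin 2) ℂ :=
  diagonal_mem_unitaryGroup _ fun i => by
    unfold torV
    split_ifs
    · exact hx
    · simp

/-- (Ported verbatim from the HodgeCMPerL package; no docstring in the source.) -/
theorem coeff_rowSubst_torV (a : Fin 2) (x : ℂ) (f : PlaneModel) (m : PlaneVar →₀ ℕ) :
    coeff m (rowSubst (Matrix.diagonal (torV a x)) 1 f)
      = coeff m f * x ^ (m (Sum.inl (a, 0)) + m (Sum.inl (a, 1))) := by
  rw [rowSubst_diagonal, coeff_scale, scaleFactor_eq_prod]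
  congr 1
  fin_cases a <;> simp [Fintype.prod_sum_type, Fintype.prod_prod_type, Fin.prod_univ_two, torV, pow_add]

/-- (Ported verbatim from the HodgeCMPerL package; no docstring in the source.) -/
theorem coeff_rowSubst_one (x : ℂ) (f : PlaneModel) (m : PlaneVar →₀ ℕ) :
    coeff m (rowSubst 1 (conj x) f) = coeff m f * x ^ (m (Sum.inr 0) + m (Sum.inr 1)) := by
  rw [← Matrix.diagonal_one, rowSubst_diagonal, coeff_scale, scaleFactor_eq_prod, Complex.conj_conj]
  congr 1
  simp [Fintype.prod_sum_type, Fin.prod_univ_two, pow_add]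

/-- (Ported verbatim from the HodgeCMPerL package; no docstring in the source.) -/
theorem wt_rowWt' (a : Fin 2) (m : PlaneVar →₀ ℕ) :
    wt (rowWt a) m = ((m (Sum.inl (a, 0)) + m (Sum.inl (a, 1)) : ℕ) : ℤ) := by
  simp only [wt, rowWt, Fintype.sum_sum_type, Fintype.sum_prod_type, Fin.sum_univ_two, Nat.cast_add]
  fin_cases a <;> simp

/-- (Ported verbatim from the HodgeCMPerL package; no docstring in the source.) -/
theorem wt_wWt' (m : PlaneVar →₀ ℕ) : wt wWt m = ((m (Sum.inr 0) + m (Sum.inr 1) : ℕ) : ℤ) := by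
  simp only [wt, wWt, Fintype.sum_sum_type, Fintype.sum_prod_type, Fin.sum_univ_two, Nat.cast_add]
  simp

/-- Row sums `(1,1)`: the torus `diag(ζ,1), diag(1,ζ)` of `U(2)_V` acting by `det = ζ` forces every monomial of a
group-level `κ`-vector to have row weights `(1,1)` — pv12's `weightOp (rowWt a) f = f`. -/
theorem IsKappaVectorGrp.weightOp_rowWt {f : PlaneModel} (h : IsKappaVectorGrp f) (a : Fin 2) :
    weightOp (rowWt a) f = f := by
  classical
  ext m
  rw [coeff_weightOp, wt_rowWt']
  by_cases hm : m ∈ f.support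
  · have hc : coeff m f ≠ 0 := MvPolynomial.mem_support_iff.mp hm
    generalize hr : m (Sum.inl (a, 0)) + m (Sum.inl (a, 1)) = r
    have hN : r + 2 ≠ 0 := by omega
    have h1 := congrArg (coeff m) (h _ (torV_mem a (ζ_mul_conj (r + 2) hN)) 1 (by simp))
    rw [coeff_rowSubst_torV, hr, det_torV, coeff_smul, smul_eq_mul, mul_comm (ζ (r + 2)) (coeff m f)] at h1
    have hpow : ζ (r + 2) ^ r = ζ (r + 2) ^ 1 := by rw [pow_one]; exact mul_left_cancel₀ hc h1
    have hr1 : r = 1 := (ζ_prim (r + 2) hN).pow_inj (by omega) (by omega) hpow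
    rw [hr1]
    simp
  · simp [MvPolynomial.notMem_support_iff.mp hm]

/-- `|E| = 0`: `t ∈ U(1)_V` acting trivially (beyond the vacuum character) forces `w`-degree `0` — pv12's
`weightOp wWt f = 0`. -/
theorem IsKappaVectorGrp.weightOp_wWt {f : PlaneModel} (h : IsKappaVectorGrp f) : weightOp wWt f = 0 := by
  classical
  ext m
  rw [coeff_weightOp, wt_wWt', coeff_zero]
  by_cases hm : m ∈ f.support
  · have hc : coeff m f ≠ 0 := MvPolynomial.mem_support_iff.mp hm
    generalize he : m (Sum.inr 0) + m (Sum.inr 1) = e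
    have hN : e + 1 ≠ 0 := by omega
    have h1 := congrArg (coeff m)
      (h 1 (Submonoid.one_mem _) (conj (ζ (e + 1))) (by rw [Complex.norm_conj]; exact norm_ζ _ hN))
    rw [coeff_rowSubst_one, he, Matrix.det_one, one_smul] at h1
    have hpow : ζ (e + 1) ^ e = 1 := mul_left_cancel₀ hc (h1.trans (mul_one _).symm)
    rw [eq_zero_of_ζ_pow_eq_one (by omega) hpow]
    simp
  · simp [MvPolynomial.notMem_support_iff.mp hm]

/-! ### The Weyl element of `U(2)_V` -/

/-- The permutation matrix `(0 1; 1 0) ∈ U(2)_V` (determinant `−1`). -/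
def swapM : Matrix (Fin 2) (Fin 2) ℂ := !![0, 1; 1, 0]

/-- (Ported verbatim from the HodgeCMPerL package; no docstring in the source.) -/
theorem swapM_mem : swapM ∈ Matrix.unitaryGroup (Fin 2) ℂ := by
  rw [Matrix.mem_unitaryGroup_iff]
  ext i j
  fin_cases i <;> fin_cases j <;> simp [swapM, Matrix.mul_apply, Fin.sum_univ_two, Matrix.star_apply]

/-- (Ported verbatim from the HodgeCMPerL package; no docstring in the source.) -/
theorem det_swapM : swapM.det = -1 := by
  rw [swapM, Matrix.det_fin_two_of]; ring

/-- (Ported verbatim from the HodgeCMPerL package; no docstring in the source.) -/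
theorem rowSubst_swapM_z (t : ℂ) (a j : Fin 2) : rowSubst swapM t (z a j) = z (1 - a) j := by
  rw [rowSubst_z]
  fin_cases a <;> simp [swapM, Fin.sum_univ_two]

/-- Coefficient extraction on the four weight-`κ` monomials. -/
theorem coeff_μ_sum (d : Fin 2 × Fin 2 → ℂ) (q : Fin 2 × Fin 2) :
    coeff (μ q.1 q.2) (∑ p : Fin 2 × Fin 2, d p • (z 0 p.1 * z 1 p.2)) = d q := by
  classical
  simp only [coeff_sum, coeff_smul, z_mul_z, coeff_monomial, smul_eq_mul, mul_ite, mul_zero]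
  rw [Finset.sum_eq_single q]
  · rw [if_pos rfl, mul_one]
  · intro p _ hne
    rw [if_neg]
    intro heq
    exact hne (μ_injective (a₁ := p) (a₂ := q) heq)
  · intro hq; exact absurd (Finset.mem_univ q) hq

/-- PerL l. 509 at group level: a group-level `κ`-vector is a multiple of `det(z)`.  Torus ⇒ weights `(1,1; |E|=0)`
(pv12 `eq_sum_of_weights`: `f = Σ c_{jj'} z_{0j} z_{1j'}`); the Weyl element `(0 1; 1 0)` acting by `det = −1`
⇒ `c_{j'j} = −c_{jj'}`, i.e. `f = c_{01} · det(z)`. -/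
theorem IsKappaVectorGrp.eq_smul_detZ {f : PlaneModel} (h : IsKappaVectorGrp f) : f = c f 0 1 • detZ := by
  have hsum := eq_sum_of_weights (h.weightOp_rowWt 0) (h.weightOp_rowWt 1) h.weightOp_wWt
  have hS := h swapM swapM_mem 1 (by simp)
  rw [det_swapM] at hS
  have hL : rowSubst swapM 1 f = ∑ p : Fin 2 × Fin 2, c f p.2 p.1 • (z 0 p.1 * z 1 p.2) := by
    conv_lhs => rw [hsum]
    rw [map_sum]
    simp only [map_smul, map_mul, rowSubst_swapM_z, Fin.isValue, sub_zero, sub_self]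
    simp only [Fintype.sum_prod_type, Fin.sum_univ_two, smul_eq_C_mul]
    ring
  have key : ∀ j j' : Fin 2, c f j' j = -c f j j' := by
    intro j j'
    have e1 := congrArg (coeff (μ j j')) hL
    have e2 := congrArg (coeff (μ j j')) hS
    rw [coeff_μ_sum (fun p : Fin 2 × Fin 2 => c f p.2 p.1) (j, j')] at e1
    rw [coeff_smul, smul_eq_mul, neg_one_mul] at e2
    rw [← e1, e2]
    rfl
  have e00 : c f 0 0 = 0 := by linear_combination (key 0 0) / 2
  have e11 : c f 1 1 = 0 := by linear_combination (key 1 1) / 2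
  have e10 : c f 1 0 = -c f 0 1 := key 0 1
  calc f = ∑ p : Fin 2 × Fin 2, c f p.1 p.2 • (z 0 p.1 * z 1 p.2) := hsum
    _ = c f 0 1 • detZ := by
        simp only [Fintype.sum_prod_type, Fin.sum_univ_two, e00, e11, e10, detZ, zero_smul, zero_add,
          add_zero, neg_smul, sub_eq_add_neg, smul_add, smul_neg]

/-- **(I) at group level — `𝓕^κ_{ι₁} = ℂ·det(z)`** (PerL l. 509). -/
theorem isKappaVectorGrp_iff (f : PlaneModel) : IsKappaVectorGrp f ↔ ∃ a : ℂ, f = a • detZ :=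
  ⟨fun h => ⟨c f 0 1, h.eq_smul_detZ⟩, by rintro ⟨a, rfl⟩; exact isKappaVectorGrp_smul_detZ a⟩

/-- Group level ⟺ pv12's Lie-algebra level (`Fock.IsKappaVector`: weights `(1,1;0)` and killed by `E₊, E₋` of
`𝔰𝔩₂(V⁺)`; `Fock.isKappaVector_iff`): the two typings of "`κ`-isotypic" in `ℂ[z_{aj}, w_j]` agree. -/
theorem isKappaVectorGrp_iff_isKappaVector (f : PlaneModel) : IsKappaVectorGrp f ↔ IsKappaVector f := by
  rw [isKappaVectorGrp_iff, isKappaVector_iff]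

end Plane


/-! ## §2  (M) `b ∈ Σ₁₂` — PerL ll. 501–502 verbatim: "model $\C[z_1,z_2,z_3,w_1,w_2,w_3]$ with $\U(3)$ acting by
the standard representation on $z$ and its dual on $w$ …, invariants $\C[P]$, $P=\sum_az_aw_a$" — at GROUP level -/

section Mixed

/-- The substitution by which a pair `(A, B) ∈ M₃(ℂ)²` acts on `ℂ[z, w] = MixedModel`: `z_a ↦ Σ_b A_{ab} z_b`,
`w_a ↦ Σ_b B_{ab} w_b`.  For `A ∈ U(3)` PerL's action is `(A, Ā)`: the standard representation on `z` and its dual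
(`(Aᵀ)⁻¹ = Ā` on `U(3)`) on `w`. -/
noncomputable def mixedSubstFun (A B : Matrix (Fin 3) (Fin 3) ℂ) : MixedVar → MixedModel
  | Sum.inl a => ∑ b : Fin 3, A a b • mz b
  | Sum.inr a => ∑ b : Fin 3, B a b • mw b

/-- `(A, B) · f`. -/
noncomputable def mixedSubst (A B : Matrix (Fin 3) (Fin 3) ℂ) : MixedModel →ₐ[ℂ] MixedModel :=
  aeval (mixedSubstFun A B)

/-- (Ported verbatim from the HodgeCMPerL package; no docstring in the source.) -/
theorem mixedSubst_mz (A B : Matrix (Fin 3) (Fin 3) ℂ) (a : Fin 3) :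
    mixedSubst A B (mz a) = ∑ b : Fin 3, A a b • mz b := by
  rw [mixedSubst, mz, aeval_X]; rfl

/-- (Ported verbatim from the HodgeCMPerL package; no docstring in the source.) -/
theorem mixedSubst_mw (A B : Matrix (Fin 3) (Fin 3) ℂ) (a : Fin 3) :
    mixedSubst A B (mw a) = ∑ b : Fin 3, B a b • mw b := by
  rw [mixedSubst, mw, aeval_X]; rfl

/-- **`U(3)`-invariant at group level**: `(A, Ā) · f = f` for every unitary `A`. -/
def IsU3InvariantGrp (f : MixedModel) : Prop :=
  ∀ A ∈ Matrix.unitaryGroup (Fin 3) ℂ, mixedSubst A (A.map (starRingEnd ℂ)) f = f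

/-! ### `P = Σ z_a w_a` is invariant (indeed under every pair with `Aᵀ B = 1`) -/

/-- (Ported verbatim from the HodgeCMPerL package; no docstring in the source.) -/
theorem mixedSubst_P {A B : Matrix (Fin 3) (Fin 3) ℂ}
    (hd : ∀ b : Fin 3, ∑ a : Fin 3, A a b * B a b = 1)
    (ho : ∀ b c : Fin 3, b ≠ c → ∑ a : Fin 3, A a b * B a c = 0) : mixedSubst A B P = P := by
  have ed : ∀ b : Fin 3,
      (C (A 0 b) * C (B 0 b) + C (A 1 b) * C (B 1 b) + C (A 2 b) * C (B 2 b) : MixedModel) = 1 := by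
    intro b
    have h := congrArg (C : ℂ → MixedModel) (hd b)
    rwa [Fin.sum_univ_three, map_add, map_add, map_mul, map_mul, map_mul, map_one] at h
  have eo : ∀ b c : Fin 3, b ≠ c →
      (C (A 0 b) * C (B 0 c) + C (A 1 b) * C (B 1 c) + C (A 2 b) * C (B 2 c) : MixedModel) = 0 := by
    intro b c hbc
    have h := congrArg (C : ℂ → MixedModel) (ho b c hbc)
    rwa [Fin.sum_univ_three, map_add, map_add, map_mul, map_mul, map_mul, map_zero] at h
  simp only [P, map_add, map_mul, mixedSubst_mz, mixedSubst_mw, Fin.sum_univ_three, smul_eq_C_mul]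
  linear_combination (mz 0 * mw 0) * ed 0 + (mz 1 * mw 1) * ed 1 + (mz 2 * mw 2) * ed 2
    + (mz 0 * mw 1) * eo 0 1 (by decide) + (mz 0 * mw 2) * eo 0 2 (by decide)
    + (mz 1 * mw 0) * eo 1 0 (by decide) + (mz 1 * mw 2) * eo 1 2 (by decide)
    + (mz 2 * mw 0) * eo 2 0 (by decide) + (mz 2 * mw 1) * eo 2 1 (by decide)

/-- For unitary `A`: `Σ_a A_{ab} conj(A_{ac}) = δ_{bc}` (the `(c,b)` entry of `AᴴA = 1`). -/
theorem sum_mul_conj_eq {A : Matrix (Fin 3) (Fin 3) ℂ} (hA : A ∈ Matrix.unitaryGroup (Fin 3) ℂ) (b c : Fin 3) :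
    ∑ a : Fin 3, A a b * (A.map (starRingEnd ℂ)) a c = if b = c then 1 else 0 := by
  have h := Matrix.mem_unitaryGroup_iff'.mp hA
  have hcb := congrFun (congrFun h c) b
  rw [Matrix.mul_apply, Matrix.star_eq_conjTranspose, Matrix.one_apply] at hcb
  simp only [Matrix.conjTranspose_apply, Matrix.map_apply, Complex.star_def] at hcb ⊢
  simp_rw [mul_comm (A _ b)]
  rw [hcb]
  simp only [eq_comm]

/-- (Ported verbatim from the HodgeCMPerL package; no docstring in the source.) -/
theorem mixedSubst_P_of_mem {A : Matrix (Fin 3) (Fin 3) ℂ} (hA : A ∈ Matrix.unitaryGroup (Fin 3) ℂ) :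
    mixedSubst A (A.map (starRingEnd ℂ)) P = P :=
  mixedSubst_P (fun b => by rw [sum_mul_conj_eq hA, if_pos rfl])
    (fun b c hbc => by rw [sum_mul_conj_eq hA, if_neg hbc])

/-- (Ported verbatim from the HodgeCMPerL package; no docstring in the source.) -/
theorem isU3InvariantGrp_of_mem_span {f : MixedModel}
    (hf : f ∈ Submodule.span ℂ (Set.range fun k : ℕ => P ^ k)) : IsU3InvariantGrp f := by
  intro A hA
  refine Submodule.span_induction (p := fun g _ => mixedSubst A (A.map (starRingEnd ℂ)) g = g) ?_ ?_ ?_ ?_ hf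
  · rintro _ ⟨k, rfl⟩
    simp only [map_pow, mixedSubst_P_of_mem hA]
  · exact map_zero _
  · intro g g' _ _ hg hg'
    rw [map_add, hg, hg']
  · intro r g _ hg
    rw [map_smul, hg]

/-! ### Torus ⇒ balanced support -/

/-- (Ported verbatim from the HodgeCMPerL package; no docstring in the source.) -/
theorem mixedSubst_diagonal (d d' : Fin 3 → ℂ) :
    mixedSubst (Matrix.diagonal d) (Matrix.diagonal d') = scale (Sum.elim d d') := by
  refine MvPolynomial.algHom_ext fun v => ?_
  rw [scale_X]
  rcases v with a | a
  · rw [show (X (Sum.inl a) : MixedModel) = mz a from rfl, mixedSubst_mz]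
    simp [Matrix.diagonal_apply, smul_eq_C_mul, mz]
  · rw [show (X (Sum.inr a) : MixedModel) = mw a from rfl, mixedSubst_mw]
    simp [Matrix.diagonal_apply, smul_eq_C_mul, mw]

/-- The torus element of `U(3)` with `x` in position `a` and `1` elsewhere. -/
noncomputable def torM (a : Fin 3) (x : ℂ) : Fin 3 → ℂ := fun b => if b = a then x else 1

/-- (Ported verbatim from the HodgeCMPerL package; no docstring in the source.) -/
theorem torM_mem (a : Fin 3) {x : ℂ} (hx : x * conj x = 1) :
    Matrix.diagonal (torM a x) ∈ Matrix.unitaryGroup (Fin 3) ℂ :=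
  diagonal_mem_unitaryGroup _ fun i => by
    unfold torM
    split_ifs
    · exact hx
    · simp

/-- (Ported verbatim from the HodgeCMPerL package; no docstring in the source.) -/
theorem diagonal_torM_map (a : Fin 3) (x : ℂ) :
    (Matrix.diagonal (torM a x)).map (starRingEnd ℂ) = Matrix.diagonal (torM a (conj x)) := by
  rw [Matrix.diagonal_map (map_zero _)]
  congr 1
  funext b
  unfold torM
  split_ifs
  · rfl
  · exact map_one _

/-- (Ported verbatim from the HodgeCMPerL package; no docstring in the source.) -/
theorem coeff_mixedSubst_torM (a : Fin 3) (x y : ℂ) (f : MixedModel) (m : MixedVar →₀ ℕ) :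
    coeff m (mixedSubst (Matrix.diagonal (torM a x)) (Matrix.diagonal (torM a y)) f)
      = coeff m f * (x ^ m (Sum.inl a) * y ^ m (Sum.inr a)) := by
  rw [mixedSubst_diagonal, coeff_scale, scaleFactor_eq_prod]
  congr 1
  fin_cases a <;> simp [Fintype.prod_sum_type, torM]

/-- PerL l. 502 "invariants": the diagonal torus of `U(3)` (`z_a ↦ ζ z_a`, `w_a ↦ ζ̄ w_a`) fixes `f` only if every
monomial `z^α w^β` of `f` is balanced, `α = β` — pv12's `balanced_of_torus` at group level. -/
theorem IsU3InvariantGrp.balanced {f : MixedModel} (h : IsU3InvariantGrp f) {m : MixedVar →₀ ℕ}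
    (hm : m ∈ f.support) (a : Fin 3) : m (Sum.inl a) = m (Sum.inr a) := by
  classical
  have hc : coeff m f ≠ 0 := MvPolynomial.mem_support_iff.mp hm
  generalize hp : m (Sum.inl a) = p
  generalize hq : m (Sum.inr a) = q
  have hN : p + q + 1 ≠ 0 := by omega
  have hζ := ζ_mul_conj (p + q + 1) hN
  have h1 := congrArg (coeff m) (h _ (torM_mem a hζ))
  rw [diagonal_torM_map, coeff_mixedSubst_torM, hp, hq] at h1
  have hfac : ζ (p + q + 1) ^ p * conj (ζ (p + q + 1)) ^ q = 1 :=
    mul_left_cancel₀ hc (h1.trans (mul_one _).symm)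
  have hpow : ζ (p + q + 1) ^ p = ζ (p + q + 1) ^ q := by
    calc ζ (p + q + 1) ^ p = ζ (p + q + 1) ^ p * (conj (ζ (p + q + 1)) * ζ (p + q + 1)) ^ q := by
          rw [mul_comm (conj _), hζ, one_pow, mul_one]
      _ = ζ (p + q + 1) ^ p * conj (ζ (p + q + 1)) ^ q * ζ (p + q + 1) ^ q := by rw [mul_pow, mul_assoc]
      _ = ζ (p + q + 1) ^ q := by rw [hfac, one_mul]
  exact (ζ_prim (p + q + 1) hN).pow_inj (by omega) (by omega) hpow

/-! ### Balanced polynomials are polynomials in the products `y_a := z_a w_a` -/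

/-- `y_a ↦ z_a w_a`: `ℂ[y₁,y₂,y₃] → ℂ[z,w]`. -/
noncomputable def diagSubst : MvPolynomial (Fin 3) ℂ →ₐ[ℂ] MixedModel :=
  aeval fun a => mz a * mw a

/-- (Ported verbatim from the HodgeCMPerL package; no docstring in the source.) -/
theorem diagSubst_X (a : Fin 3) : diagSubst (X a) = mz a * mw a := by
  rw [diagSubst, aeval_X]

/-- (Ported verbatim from the HodgeCMPerL package; no docstring in the source.) -/
theorem diagSubst_P : diagSubst (X 0 + X 1 + X 2) = P := by
  simp only [map_add, diagSubst_X, P, Fin.sum_univ_three]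

/-- (Ported verbatim from the HodgeCMPerL package; no docstring in the source.) -/
theorem sum_pair_eq_bal (γ : Fin 3 →₀ ℕ) :
    ∑ a : Fin 3, (single (Sum.inl a) (γ a) + single (Sum.inr a) (γ a) : MixedVar →₀ ℕ) = bal γ := by
  classical
  ext v
  rw [Finsupp.coe_finsetSum, Finset.sum_apply]
  rcases v with a | a <;> fin_cases a <;> simp [bal, sumElim_inl, sumElim_inr, single_apply]

/-- (Ported verbatim from the HodgeCMPerL package; no docstring in the source.) -/
theorem diagSubst_monomial (γ : Fin 3 →₀ ℕ) (r : ℂ) : diagSubst (monomial γ r) = monomial (bal γ) r := by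
  classical
  rw [diagSubst, aeval_monomial, Finsupp.prod_pow, ← sum_pair_eq_bal, monomial_sum_index]
  congr 1
  refine Finset.prod_congr rfl fun a _ => ?_
  rw [mul_pow, mz, mw, X_pow_eq_monomial, X_pow_eq_monomial, monomial_mul, one_mul]

/-- The contraction `z^γ w^γ ↦ y^γ` of a (balanced) polynomial. -/
noncomputable def contract (f : MixedModel) : MvPolynomial (Fin 3) ℂ :=
  ∑ m ∈ f.support, monomial (half m) (coeff m f)

/-- (Ported verbatim from the HodgeCMPerL package; no docstring in the source.) -/
theorem diagSubst_contract {f : MixedModel} (hbal : ∀ m ∈ f.support, ∀ a, m (Sum.inl a) = m (Sum.inr a)) :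
    diagSubst (contract f) = f := by
  rw [contract, map_sum]
  conv_rhs => rw [f.as_sum]
  refine Finset.sum_congr rfl fun m hm => ?_
  rw [diagSubst_monomial, bal_half (hbal m hm)]

/-! ### Point evaluations -/

/-- (Ported verbatim from the HodgeCMPerL package; no docstring in the source.) -/
theorem aeval_mixedSubst (A B : Matrix (Fin 3) (Fin 3) ℂ) (x : MixedVar → ℂ) (f : MixedModel) :
    aeval x (mixedSubst A B f) =
      aeval (Sum.elim (fun a => ∑ b, A a b * x (Sum.inl b)) (fun a => ∑ b, B a b * x (Sum.inr b))) f := by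
  rw [mixedSubst, aeval_eq_bind₁ (mixedSubstFun A B), aeval_bind₁]
  refine congrArg (fun g : MixedVar → ℂ => aeval g f) (funext fun v => ?_)
  rcases v with a | a <;> simp [mixedSubstFun, mz, mw, smul_eq_mul]

/-- (Ported verbatim from the HodgeCMPerL package; no docstring in the source.) -/
theorem aeval_diagSubst (x : MixedVar → ℂ) (F : MvPolynomial (Fin 3) ℂ) :
    aeval x (diagSubst F) = aeval (fun a => x (Sum.inl a) * x (Sum.inr a)) F := by
  rw [diagSubst, aeval_eq_bind₁ (fun a => mz a * mw a), aeval_bind₁]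
  refine congrArg (fun g : Fin 3 → ℂ => aeval g F) (funext fun a => ?_)
  simp [mz, mw]

/-! ### Two rational rotations in `SO(3) ⊂ U(3)` (the `3-4-5` angle) -/

/-- Rotation by the angle `θ` with `cos θ = 3/5` in the `(z₁,z₂)`-plane. -/
noncomputable def R01 : Matrix (Fin 3) (Fin 3) ℂ := !![3/5, -4/5, 0; 4/5, 3/5, 0; 0, 0, 1]


-- port_pkg: scope closed for this part
end Mixed
end GroupLevel
end Fock
end PerL34
end HodgeCM
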